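import Mathlib
import Literature.Computability.AlgebraicComplexity.FS13GeneratorHitsROABP
import HarnessLib

/-!
# FSV 2018 Lemma 55 (the Forbes–Shpilka generator for roABPs) in the SAFE reading — PROVED over
# every field (base change to an infinite extension); no statements, no named facts

M. A. Forbes, A. Shpilka, B. L. Volk, *Succinct hitting sets and barriers to proving lower bounds
for algebraic circuits*, ToC 14 (2018) = arXiv:1701.05328 [ForbesShpilkaVolk2018], Lemma 55
(= ToC Lemma 7.1) = [ForbesShpilka2013, Construction 3.13 / Thm. 3.21]. The tree's named fact
`ForbesShpilkaVolk2018_lemma55` (`FSV2018ROABP.lean`) types FSV's sentence verbatim; val-lit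
PRINT-ERRATA B13 / lead-np ruling (23) record that FSV quotes [FS13] with the strict/non-strict
individual-degree convention untranslated, and direct that "any discharge targets the safe reading
`d ↦ d+1` in both places as a sibling `ForbesShpilkaVolk2018_lemma55_safe`". This file proves
that sibling, as a THEOREM:

`ForbesShpilkaVolk2018_lemma55_safe`: for every field `F`, `n w d`, `ω ∈ F`, nodes
`β : [w²] → F` injective, `ω ≠ 0`, `ω^k ≠ 1` for `0 < k < (2ⁿ(d+1)w²)²`: the map
`fsGenCoord n w (d+1) ω β` (FSV eq. (7.1) with `d ↦ d+1`) is a hitting-set generator for the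
polynomials computed by width-`w`, individual-degree-`d` roABPs in the order `X_1, …, X_N`.

Proof: the infinite-field case is `ForbesShpilkaVolk2018_lemma55_safe_of_infinite` ([FS13, Lemma
3.20] via span preservation); a general `F` embeds into the infinite field `K = Frac(F[u])`, the
roABP and the generator are mapped along (`map_fsGenCoord`: (7.1) is natural in the field), and
`D ∘ 𝒢 ≠ 0` descends because `MvPolynomial.map` is injective. Nothing here bears on `VP ≠ VNP`.

## References
* [ForbesShpilkaVolk2018] Lemma 55 (seq.; = arXiv v2 / ToC Lemma 7.1), eq. (7.1) (locator:
  paper:arxiv-1701.05328 chunk p0023.txt:L9–L25).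
* [ForbesShpilka2013] arXiv:1209.2408 §3.2 Construction 15, Lemmas 19–20, Thm. 21 (arXiv numbering).
-/

noncomputable section

open MvPolynomial Finset

open scoped BigOperators

namespace Literature.Computability.AlgebraicComplexity

namespace FS2013

variable {F K : Type*} [Field F] [Field K] (ι : F →+* K)

/-- `map ι (p(q)) = (p.map ι)(map ι q)` for a univariate `p` substituted with a multivariate `q`.
[folklore] -/
private theorem map_polynomial_aeval {σ : Type*} (q : MvPolynomial σ F) (p : Polynomial F) :
    MvPolynomial.map ι (Polynomial.aeval q p) = Polynomial.aeval (MvPolynomial.map ι q) (p.map ι) := by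
  induction p using Polynomial.induction_on' with
  | add p q hp hq => rw [map_add, map_add, Polynomial.map_add, map_add, hp, hq]
  | monomial k a =>
    rw [Polynomial.map_monomial, Polynomial.aeval_monomial, Polynomial.aeval_monomial, map_mul,
      map_pow, MvPolynomial.algebraMap_eq, MvPolynomial.algebraMap_eq, MvPolynomial.map_C]

/-- The Lagrange polynomials are natural in the field: `(p_ℓ for β).map ι = p_ℓ for ι ∘ β`.
[folklore] -/
private theorem map_fsBasis {w : ℕ} (β : Fin (w ^ 2) → F) (o : Option (Fin (w ^ 2))) :
    (fsBasis β o).map ι = fsBasis (ι ∘ β) o := by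
  classical
  cases o with
  | none => exact Polynomial.map_X ι
  | some ℓ =>
    show (Lagrange.basis Finset.univ β ℓ).map ι = Lagrange.basis Finset.univ (ι ∘ β) ℓ
    unfold Lagrange.basis
    rw [Polynomial.map_prod]
    refine Finset.prod_congr rfl fun j _ => ?_
    unfold Lagrange.basisDivisor
    rw [Polynomial.map_mul, Polynomial.map_sub, Polynomial.map_C, Polynomial.map_X,
      Polynomial.map_C, map_inv₀, map_sub]
    rfl

/-- **FSV eq. (7.1) is natural in the field:** `map ι (𝒢_m for (ω, β)) = 𝒢_m for (ι ω, ι ∘ β)`.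
[cite: ForbesShpilkaVolk2018, Lemma 55 eq. (7.1) (seq.; = ToC Lemma 7.1)]
locator: paper:arxiv-1701.05328 chunk p0023.txt:L19–L25 -/
theorem map_fsGenCoord (n w d : ℕ) (ω : F) (β : Fin (w ^ 2) → F) (m : multilinearMonomials n) :
    MvPolynomial.map ι (fsGenCoord n w d ω β m) = fsGenCoord n w d (ι ω) (ι ∘ β) m := by
  classical
  unfold fsGenCoord
  rw [map_sum]
  refine Finset.sum_congr rfl fun ℓ _ => ?_
  have harg : ∀ i : Fin n, MvPolynomial.map ι (fsArg ω ℓ i) = fsArg (ι ω) ℓ i := by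
    intro i
    unfold fsArg
    rw [map_mul, MvPolynomial.map_C, map_pow, MvPolynomial.map_X]
  rw [map_mul, map_prod, map_polynomial_aeval, map_fsBasis, MvPolynomial.map_X]
  congr 1
  refine Finset.prod_congr rfl fun i _ => ?_
  split_ifs
  · rw [map_polynomial_aeval, map_fsBasis, harg]
  · rw [map_polynomial_aeval, map_fsBasis, map_pow, harg]

/-- roABPs base-change: the image of a width-`w`, individual-degree-`d` roABP polynomial under a
field embedding is one (same layers, coefficients mapped). [cite: ForbesShpilkaVolk2018, §5.3 (definition of roABP, seq.) = ToC §5.3]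
locator: paper:arxiv-1701.05328 p0019.txt:L79 -/
theorem isROABP_map {ι' : Type*} {N w d : ℕ} (π : Fin N ≃ ι') {D : MvPolynomial ι' F}
    (hD : IsROABP F w d π D) : IsROABP K w d π (MvPolynomial.map ι D) := by
  obtain ⟨hw, M, hM, hDM⟩ := hD
  choose p hpdeg hpM using hM
  refine ⟨hw, fun i => (M i).map (MvPolynomial.map ι), fun i a b => ⟨(p i a b).map ι, ?_, ?_⟩, ?_⟩
  · exact Polynomial.natDegree_map_le.trans (hpdeg i a b)
  · show (M i).map (MvPolynomial.map ι) a b = _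
    rw [Matrix.map_apply, hpM, map_polynomial_aeval, MvPolynomial.map_X]
  · show _ = (List.ofFn fun i => (M i).map (MvPolynomial.map ι)).prod ⟨0, hw⟩ ⟨0, hw⟩
    rw [hDM, ← FS2013.map_listProd_ofFn, Matrix.map_apply]

end FS2013

open Literature.Barriers.ValiantsHypothesis in
/-- **FSV 2018 Lemma 55 (ToC Lemma 7.1) in the SAFE reading — PROVED (every field).** "Let
`n ∈ ℕ` and `N = 2ⁿ`. … Let `ω ∈ 𝔽` be of multiplicative order at least `(N d w²)²` [safe:
`(N (d+1) w²)²`], and `β_1, …, β_{w²}` be distinct elements of `𝔽` … the polynomial map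
`𝒢^{FS} : 𝔽^{n+1} → 𝔽^N` [eq. (7.1), safe: exponent `2^{i-1} (d+1) w²`, i.e. `fsGenCoord n w (d+1)`]
is a generator for width `w`, individual degree `d`, `N`-variate roABPs, in variable order
`X_1, X_2, …, X_N`." This is [FS13, Construction 3.13 / Thm. 3.21] with FS13's strict degree
bound `n_FS13 = d + 1`; the verbatim FSV sentence (`ForbesShpilkaVolk2018_lemma55`, exponent and
order with `d`) stays a named fact (truth undecided, val-lit B13).
[cite: ForbesShpilkaVolk2018, Lemma 55 (seq.; = arXiv v2 / ToC Lemma 7.1); ForbesShpilka2013, Construction 15, Lemmas 19–20, Theorem 21 (arXiv numbering; §3.2)]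
locator: paper:arxiv-1701.05328 chunk p0023.txt:L9–L25; paper:arxiv-1209.2408 p0015.txt:L19 – p0017.txt:L4 -/
theorem ForbesShpilkaVolk2018_lemma55_safe {F : Type*} [Field F] (n w d : ℕ) (ω : F)
    (β : Fin (w ^ 2) → F) (hβ : Function.Injective β) (hω0 : ω ≠ 0)
    (hord : ∀ k : ℕ, 0 < k → k < (2 ^ n * (d + 1) * w ^ 2) ^ 2 → ω ^ k ≠ 1) :
    IsHittingSetGenerator
      {D : MvPolynomial (multilinearMonomials n) F | IsROABP F w d (binaryOrder n) D}
      (fsGenCoord n w (d + 1) ω β) := by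
  classical
  intro D hD hD0 hcomp
  -- base change to the infinite field `K = Frac(F[u])`
  let K := FractionRing (Polynomial F)
  let ι : F →+* K := algebraMap F K
  have hι : Function.Injective ι := (algebraMap F K).injective
  haveI : Infinite K := Infinite.of_injective _
    (IsFractionRing.injective (Polynomial F) (FractionRing (Polynomial F)))
  have hD' : IsROABP K w d (binaryOrder n) (MvPolynomial.map ι D) := FS2013.isROABP_map ι _ hD
  have hD0' : MvPolynomial.map ι D ≠ 0 := fun h =>
    hD0 (MvPolynomial.map_injective ι hι (by rw [h, map_zero]))
  have hβ' : Function.Injective (ι ∘ β) := hι.comp hβ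
  have hω0' : ι ω ≠ 0 := fun h => hω0 (hι (by rw [h, map_zero]))
  have hord' : ∀ k : ℕ, 0 < k → k < (2 ^ n * (d + 1) * w ^ 2) ^ 2 → ι ω ^ k ≠ 1 := by
    intro k hk hk' h
    refine hord k hk hk' (hι ?_)
    rw [map_pow, h, map_one]
  have hgen := ForbesShpilkaVolk2018_lemma55_safe_of_infinite (F := K) n w d (ι ω) (ι ∘ β) hβ'
    hω0' hord' _ hD' hD0'
  apply hgen
  have hnat : fsGenCoord n w (d + 1) (ι ω) (ι ∘ β) =
      fun m => MvPolynomial.map ι (fsGenCoord n w (d + 1) ω β m) :=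
    funext fun m => (FS2013.map_fsGenCoord ι n w (d + 1) ω β m).symm
  rw [hnat, ← MvPolynomial.map_bind₁, hcomp, map_zero]

end Literature.Computability.AlgebraicComplexity
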